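import Summits.CriticalPhenomena.PercolationContinuityZ3.Theorems.PercNearOneGluingNoHeavyLowerTailFKHullPortTASSectionsS
import Summits.CriticalPhenomena.PercolationContinuityZ3.Theorems.PercNearOneGluingNoHeavyLowerTailFKHullPortDeltaNTools
import HarnessLib

/-!
# FK sub-lane: signs, vanishing, positivity and the (PC) cross-term for the owner-set `T^S` functionals of `φ_{𝐩,q}`

Support file (`--supports stmt-CriticalPhenomena-4575`), FK sub-lane `prim-bschramm-fk-2` (gen 3); builds on p205010 (kernel theorem,
internal audit signed; external expert review pending).  No definitions, no named facts, no sorries; standard axioms.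

The owner-set copies of `…FKHullPortDeltaNTools.lean` (this cell) for `FK.taCS … taQS` (owner `x`, owner set `S`, observer `v`,
marker `o`, avoided set `X`): `c^S ≥ 0` / `B^S ≥ 0` for monotone test functions (FKG in the world, `q ≥ 1`), `b^S ≥ 0`, the
vanishing of `B^S` when `x ∈ X` or `v ∈ X`, of `b^S` when `v ∈ S ∪ X`, positivity of `b^S` (finite energy; weight-one pairs inside
`X`, `v ∉ S ∪ X`), and the (PC) sign of the second Bernstein deformation in `tabS` form (two fractional pairs at `X`, avoided set
`S ∪ X`; `FK.exitPair_posCorrelation_rc`).  bschramm/FK-Q2.md §12.2, §12.6(c).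
[cite: Grimmett2006, Thm. (3.8)(b), Thm. (3.1), eq. (1.20)] [cite: VandenbergHaggstromKahn2005, Thm. 2.1 (p. 9), §2.1 Lemma 2.3 (p. 10)]
-/

noncomputable section

namespace Summit.CriticalPhenomena.PercolationContinuityZ3.Theorems.FK

open MeasureTheory Set Literature.Probability.LatticeModels Literature.Probability.Percolation
open Literature.Probability.Percolation.DecisionTree (ind ind_of_mem ind_of_not_mem ind_nonneg)
open Literature.Probability.Percolation.BHK2006 (rcMass delW)
open Summit.CriticalPhenomena.PercolationContinuityZ3.Theorems.HullPort (cut avoidEv connS)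
open scoped Classical

variable {V : Type*} [Fintype V]

section ToolsS

open Literature.Probability.Percolation.BHK2006 (weight rcMass_fkg rcMass_nonneg openEdgeCluster_mono coe_delW)
open Summit.CriticalPhenomena.PercolationContinuityZ3.Theorems.HullPort (insert_mem_avoidEv_iff cut_insert_edge
  edge_mem_cut eq_of_reachable_of_isolated mem_cut_of_mem)

omit [Fintype V] in
/-- `{v ↔ S}` is an increasing event. [folklore] -/
theorem isUpperSet_connS (S : Set V) (v : V) : IsUpperSet (connS S v : Set (Set (Sym2 V))) :=
  fun _ _ hle ⟨u, hu, h⟩ => ⟨u, hu, h.mono (openGraph_mono hle)⟩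

/-- `c^S(ω) ≥ 0` for a monotone test function: FKG for the world measure `φ_{G − cut, q}`, `q ≥ 1`.
[cite: Grimmett2006, Thm. (3.8)(b)] [cite: VandenbergHaggstromKahn2005, §2.1 Lemma 2.2 (p. 10)] -/
theorem taCS_nonneg (w : Sym2 V → unitInterval) {q : ℝ} (hq : 1 ≤ q) (x : V) (S : Set V) (v : V) (X : Set V)
    {g : Set (Sym2 V) → ℝ} (hg : Monotone g) (ω : Set (Sym2 V)) : 0 ≤ taCS w q x S v X g ω := by
  unfold taCS wE
  have h := rcMass_fkg (delW w (cut X ω)) hq (f := fun η => g (openEdgeCluster η x))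
    (g := fun η => ind (connS S v) η) (fun a b hab => hg (openEdgeCluster_mono hab x))
    (monotone_ind_of_isUpperSet (isUpperSet_connS S v))
  linarith

/-- `B ≥ 0` for a monotone test function (`q ≥ 1`). [cite: Grimmett2006, Thm. (3.8)(b)] -/
theorem taBS_nonneg (w : Sym2 V → unitInterval) {q : ℝ} (hq : 1 ≤ q) (x : V) (S : Set V) (v : V) (X : Set V)
    {g : Set (Sym2 V) → ℝ} (hg : Monotone g) : 0 ≤ taBS w q x S v X g :=
  Finset.sum_nonneg fun ω _ => mul_nonneg (rcWeightW_nonneg w (zero_le_one.trans hq) ∅ ω)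
    (mul_nonneg (ind_nonneg _ _) (taCS_nonneg w hq x S v X hg ω))

/-- `b ≥ 0`. [cite: Grimmett2006, §1.4 eq. (1.20) (p. 15)] -/
theorem tabS_nonneg (w : Sym2 V → unitInterval) {q : ℝ} (hq : 0 ≤ q) (S : Set V) (v : V) (X : Set V) : 0 ≤ tabS w q S v X :=
  Finset.sum_nonneg fun ω _ => mul_nonneg (rcWeightW_nonneg w hq ∅ ω) (ind_nonneg _ _)

/-- If the owner `x` lies in the avoided set then `B^S = 0` (`1{x ↮ X} ≡ 0`). [folklore] -/
theorem taBS_eq_zero_of_root_mem (w : Sym2 V → unitInterval) (q : ℝ) (x : V) (S : Set V) (v : V) (X : Set V) (hx : x ∈ X)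
    (g : Set (Sym2 V) → ℝ) : taBS w q x S v X g = 0 := by
  unfold taBS
  refine Finset.sum_eq_zero fun ω _ => ?_
  have : ω ∉ avoidEv x X := fun h => h x hx (SimpleGraph.Reachable.refl _)
  rw [ind_of_not_mem this, zero_mul, mul_zero]

/-- If `v ∈ S ∪ X` then `b^S = 0`. [folklore] -/
theorem tabS_eq_zero_of_mem (w : Sym2 V → unitInterval) (q : ℝ) (S : Set V) (v : V) (X : Set V) (hv : v ∈ S ∪ X) :
    tabS w q S v X = 0 := by
  unfold tabS
  refine Finset.sum_eq_zero fun ω _ => ?_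
  have : ω ∉ avoidEv v (S ∪ X) := fun h => h v hv (SimpleGraph.Reachable.refl _)
  rw [ind_of_not_mem this, mul_zero]

/-- In a world in which every pair at `v` is deleted, `{v ↔ S}` (`v ∉ S`) has probability `0`. [cite: VandenbergHaggstromKahn2005, §2.1 Lemma 2.3 (p. 10)] -/
theorem wE_mul_ind_connS_eq_zero (w : Sym2 V → unitInterval) (q : ℝ) {B : Set (Sym2 V)} {S : Set V} {v : V} (hvS : v ∉ S)
    (hB : ∀ e : Sym2 V, v ∈ e → e ∈ B) (F : Set (Sym2 V) → ℝ) :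
    wE w q B (fun η => F η * ind (connS S v) η) = 0 := by
  unfold wE
  refine Finset.sum_eq_zero fun η _ => ?_
  by_cases hη : ∃ e ∈ η, e ∈ B
  · obtain ⟨e, heη, heB⟩ := hη
    have h0 : ((delW w B e : unitInterval) : ℝ) = 0 := by rw [coe_delW, if_pos heB]
    have : rcMass (delW w B) q η = 0 := by
      unfold rcMass
      rw [rcWeightW_eq_zero_of_zero_mem (delW w B) q ∅ h0 heη, zero_div]
    rw [this, zero_mul]
  · have hiso : ∀ e ∈ η, v ∉ e := fun e he hye => hη ⟨e, he, hB e hye⟩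
    have hns : η ∉ connS S v := fun ⟨u, hu, h⟩ => hvS ((eq_of_reachable_of_isolated hiso u h) ▸ hu)
    show rcMass (delW w B) q η * (F η * ind (connS S v) η) = 0
    rw [ind_of_not_mem hns, mul_zero, mul_zero]

/-- `c^S ≡ 0` if `v ∈ X` (`v ∉ S`): in every world `v` is isolated. [folklore] -/
theorem taCS_eq_zero_of_mem (w : Sym2 V → unitInterval) (q : ℝ) (x : V) {S : Set V} {v : V} (hvS : v ∉ S) (X : Set V)
    (hv : v ∈ X) (g : Set (Sym2 V) → ℝ) (ω : Set (Sym2 V)) : taCS w q x S v X g ω = 0 := by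
    unfold taCS
    have h1 := wE_mul_ind_connS_eq_zero w q hvS (B := cut X ω) (fun e hye => mem_cut_of_mem hv hye ω)
      (fun η => g (openEdgeCluster η x))
    have h2 := wE_mul_ind_connS_eq_zero w q hvS (B := cut X ω) (fun e hye => mem_cut_of_mem hv hye ω) (fun _ => 1)
    have h2' : wE w q (cut X ω) (ind (connS S v)) = 0 := by
      rw [← h2]; unfold wE; simp only [one_mul]
    rw [h1, h2']
    ring

/-- If `v ∈ X` (`v ∉ S`) then `B^S = 0`. [folklore] -/
theorem taBS_eq_zero_of_mem (w : Sym2 V → unitInterval) (q : ℝ) (x : V) {S : Set V} {v : V} (hvS : v ∉ S) (X : Set V)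
    (hv : v ∈ X) (g : Set (Sym2 V) → ℝ) : taBS w q x S v X g = 0 := by
  unfold taBS
  refine Finset.sum_eq_zero fun ω _ => ?_
  rw [taCS_eq_zero_of_mem w q x hvS X hv g ω, mul_zero, mul_zero]

/-- **Positivity of `b`**: if every weight-`1` pair lies inside `X` and `v ∉ S ∪ X`, the configuration "exactly the
weight-`1` pairs open" has positive weight and isolates `v`. [cite: Grimmett2006, Thm. (3.1) eq. (3.4) (finite energy)] -/
theorem tabS_pos (w : Sym2 V → unitInterval) {q : ℝ} (hq : 0 < q) (S : Set V) {v : V} (X : Set V)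
    (hINV : ∀ e : Sym2 V, ((w e : unitInterval) : ℝ) = 1 → ∀ a ∈ e, a ∈ X) (hvSX : v ∉ S ∪ X) : 0 < tabS w q S v X := by
  classical
  have hyX : v ∉ X := fun h => hvSX (Set.mem_union_right _ h)
  unfold tabS
  set ω₁ : BondConfig V := {e | ((w e : unitInterval) : ℝ) = 1} with hω₁
  have hterm : ∀ ω, 0 ≤ rcWeightW w q ∅ ω * ind (avoidEv v (S ∪ X)) ω := fun ω =>
    mul_nonneg (rcWeightW_nonneg w hq.le ∅ ω) (ind_nonneg _ _)
  refine lt_of_lt_of_le ?_ (Finset.single_le_sum (fun ω _ => hterm ω) (Finset.mem_univ ω₁))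
  have hmem : ω₁ ∈ avoidEv v (S ∪ X) := by
    intro t ht hyt
    have hiso : ∀ e ∈ ω₁, v ∉ e := fun e he hye => hyX (hINV e he v hye)
    have hty := eq_of_reachable_of_isolated hiso t hyt
    rw [hty] at ht
    exact hvSX ht
  rw [ind_of_mem hmem, mul_one]
  unfold rcWeightW weight
  refine mul_pos (Finset.prod_pos fun e _ => ?_) (pow_pos hq _)
  by_cases he : e ∈ ω₁
  · have h1 : ((w e : unitInterval) : ℝ) = 1 := he
    rw [if_pos he]
    simp only [h1]
    exact one_pos
  · rw [if_neg he]
    have h1 : ((w e : unitInterval) : ℝ) ≠ 1 := he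
    have h2 : ((w e : unitInterval) : ℝ) ≤ 1 := (w e).2.2
    simp only
    exact sub_pos.2 (lt_of_le_of_ne h2 h1)

/-- **Two pairs touching `X` are positively correlated given avoidance, in `tabS` form**: with `e = s(a,b)`, `f = s(c,d)`,
`a, c ∈ X`, `w_{ij} = w[e↦i][f↦j]`:  `b(w₀₁, X∪{d})·b(w₁₀, X∪{b}) ≤ b(w₀₀, X)·b(w₁₁, X∪{b,d})` — the cross-term sign `(PC)` of the
second Bernstein deformation (bschramm/FK-Q2.md §12.4) for the avoided set `S ∪ X` of the owner-set functionals, from `FK.exitPair_posCorrelation_rc`.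
[cite: VandenbergHaggstromKahn2005, Thm. 2.1 (p. 9)] -/
theorem tabS_posCorr (w : Sym2 V → unitInterval) {q : ℝ} (hq : 1 ≤ q) (S : Set V) {y : V} (X : Set V) {a b c d : V}
    (ha : a ∈ X) (hab : a ≠ b) (hc : c ∈ X) (hcd : c ≠ d) (hef : s(a, b) ≠ s(c, d))
    (he0 : 0 < ((w s(a, b) : unitInterval) : ℝ)) (he1 : ((w s(a, b) : unitInterval) : ℝ) < 1)
    (hf0 : 0 < ((w s(c, d) : unitInterval) : ℝ)) (hf1 : ((w s(c, d) : unitInterval) : ℝ) < 1) :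
    tabS (Function.update (Function.update w s(a, b) 0) s(c, d) 1) q S y (insert d X) *
        tabS (Function.update (Function.update w s(a, b) 1) s(c, d) 0) q S y (insert b X) ≤
      tabS (Function.update (Function.update w s(a, b) 0) s(c, d) 0) q S y X *
        tabS (Function.update (Function.update w s(a, b) 1) s(c, d) 1) q S y (insert b (insert d X)) := by
  classical
  have hq0 : 0 < q := one_pos.trans_le hq
  set e : Sym2 V := s(a, b) with he
  set f : Sym2 V := s(c, d) with hf
  have hfe : f ≠ e := fun h => hef h.symm
  set w00 := Function.update (Function.update w e 0) f 0 with hw00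
  set w01 := Function.update (Function.update w e 0) f 1 with hw01
  set w10 := Function.update (Function.update w e 1) f 0 with hw10
  set w11 := Function.update (Function.update w e 1) f 1 with hw11
  have h10e : ((w10 e : unitInterval) : ℝ) = 1 := by simp [hw10, Function.update_of_ne hfe.symm]
  have h11e : ((w11 e : unitInterval) : ℝ) = 1 := by simp [hw11, Function.update_of_ne hfe.symm]
  have h01f : ((w01 f : unitInterval) : ℝ) = 1 := by simp [hw01]
  have h11f : ((w11 f : unitInterval) : ℝ) = 1 := by simp [hw11]
  have h00e : ((w00 e : unitInterval) : ℝ) = 0 := by simp [hw00, Function.update_of_ne hfe.symm]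
  have h01e : ((w01 e : unitInterval) : ℝ) = 0 := by simp [hw01, Function.update_of_ne hfe.symm]
  have h00f : ((w00 f : unitInterval) : ℝ) = 0 := by simp [hw00]
  have h10f : ((w10 f : unitInterval) : ℝ) = 0 := by simp [hw10]
  -- absorption: all four avoided sets become `X`
  rw [tabS_absorb w01 q S y c d X hc h01f, tabS_absorb w10 q S y a b X ha h10e,
    tabS_absorb w11 q S y a b (insert d X) (Set.mem_insert_of_mem _ ha) h11e, tabS_absorb w11 q S y c d X hc h11f]
  set D : Set (BondConfig V) := avoidEv y (S ∪ X) with hD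
  set te : ℝ := ((w e : unitInterval) : ℝ) with hte
  set tf : ℝ := ((w f : unitInterval) : ℝ) with htf
  have hwef : ((Function.update w e 0 f : unitInterval) : ℝ) = tf := by rw [Function.update_of_ne hfe]
  have hwef' : ((Function.update w e 1 f : unitInterval) : ℝ) = tf := by rw [Function.update_of_ne hfe]
  -- the four corner masses `m_{ij} = Σ_ω w_{ij}(ω) 1_D(ω) = tabS(w_{ij}, X)`
  set m00 := ∑ ω, rcWeightW w00 q ∅ ω * ind D ω with hm00
  set m01 := ∑ ω, rcWeightW w01 q ∅ ω * ind D ω with hm01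
  set m10 := ∑ ω, rcWeightW w10 q ∅ ω * ind D ω with hm10
  set m11 := ∑ ω, rcWeightW w11 q ∅ ω * ind D ω with hm11
  change m01 * m10 ≤ m00 * m11
  -- pointwise four-term decomposition
  have hpt : ∀ ω : BondConfig V, rcWeightW w q ∅ ω =
      (if e ∈ ω then (if f ∈ ω then te * tf * rcWeightW w11 q ∅ ω else te * (1 - tf) * rcWeightW w10 q ∅ ω)
        else (if f ∈ ω then (1 - te) * tf * rcWeightW w01 q ∅ ω else (1 - te) * (1 - tf) * rcWeightW w00 q ∅ ω)) := by
    intro ω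
    rw [rcWeightW_split w q ∅ e ω]
    by_cases heω : e ∈ ω
    · rw [if_pos heω, if_pos heω, rcWeightW_split (Function.update w e 1) q ∅ f ω, hwef']
      by_cases hfω : f ∈ ω
      · rw [if_pos hfω, if_pos hfω]; ring
      · rw [if_neg hfω, if_neg hfω]; ring
    · rw [if_neg heω, if_neg heω, rcWeightW_split (Function.update w e 0) q ∅ f ω, hwef]
      by_cases hfω : f ∈ ω
      · rw [if_pos hfω, if_pos hfω]; ring
      · rw [if_neg hfω, if_neg hfω]; ring
  -- vanishing of the pinned weights off their cylinders
  have z11 : ∀ ω, ¬ (e ∈ ω ∧ f ∈ ω) → rcWeightW w11 q ∅ ω = 0 := by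
    intro ω h
    by_cases heω : e ∈ ω
    · exact rcWeightW_eq_zero_of_one_not_mem w11 q ∅ h11f (fun hfω => h ⟨heω, hfω⟩)
    · exact rcWeightW_eq_zero_of_one_not_mem w11 q ∅ h11e heω
  have z10 : ∀ ω, ¬ (e ∈ ω ∧ f ∉ ω) → rcWeightW w10 q ∅ ω = 0 := by
    intro ω h
    by_cases heω : e ∈ ω
    · have hfω : f ∈ ω := by by_contra hh; exact h ⟨heω, hh⟩
      exact rcWeightW_eq_zero_of_zero_mem w10 q ∅ h10f hfω
    · exact rcWeightW_eq_zero_of_one_not_mem w10 q ∅ h10e heω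
  have z01 : ∀ ω, ¬ (e ∉ ω ∧ f ∈ ω) → rcWeightW w01 q ∅ ω = 0 := by
    intro ω h
    by_cases heω : e ∈ ω
    · exact rcWeightW_eq_zero_of_zero_mem w01 q ∅ h01e heω
    · exact rcWeightW_eq_zero_of_one_not_mem w01 q ∅ h01f (fun hfω => h ⟨heω, hfω⟩)
  have z00 : ∀ ω, ¬ (e ∉ ω ∧ f ∉ ω) → rcWeightW w00 q ∅ ω = 0 := by
    intro ω h
    by_cases heω : e ∈ ω
    · exact rcWeightW_eq_zero_of_zero_mem w00 q ∅ h00e heω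
    · have hfω : f ∈ ω := by by_contra hh; exact h ⟨heω, hh⟩
      exact rcWeightW_eq_zero_of_zero_mem w00 q ∅ h00f hfω
  -- masses of `D ∩ cylinder` under `w`
  set Oe : Set (BondConfig V) := {ω | e ∈ ω} with hOe
  set Of : Set (BondConfig V) := {ω | f ∈ ω} with hOf
  have hS : ∀ (A : Set (BondConfig V)), (rcMeasureW w q ∅).real A * rcPartitionFunctionW w q ∅ =
      ∑ ω, rcWeightW w q ∅ ω * ind A ω := by
    intro A
    rw [rcMeasureW_real_eq_sum_div w hq0 ∅ A, div_mul_cancel₀ _ (rcPartitionFunctionW_pos w hq0 ∅).ne']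
  -- S(D) = Σ c_ij m_ij, S(D ∩ Oe) = ..., S(D ∩ Of) = ..., S(D ∩ Oe ∩ Of) = ...
  have hSD : ∑ ω, rcWeightW w q ∅ ω * ind D ω =
      te * tf * m11 + te * (1 - tf) * m10 + (1 - te) * tf * m01 + (1 - te) * (1 - tf) * m00 := by
    simp only [hm00, hm01, hm10, hm11, Finset.mul_sum, ← Finset.sum_add_distrib]
    refine Finset.sum_congr rfl fun ω _ => ?_
    rw [hpt ω]
    by_cases heω : e ∈ ω <;> by_cases hfω : f ∈ ω
    · rw [if_pos heω, if_pos hfω, z10 ω (fun h => h.2 hfω), z01 ω (fun h => h.1 heω), z00 ω (fun h => h.1 heω)]; ring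
    · rw [if_pos heω, if_neg hfω, z11 ω (fun h => hfω h.2), z01 ω (fun h => h.1 heω), z00 ω (fun h => h.1 heω)]; ring
    · rw [if_neg heω, if_pos hfω, z11 ω (fun h => heω h.1), z10 ω (fun h => heω h.1), z00 ω (fun h => h.2 hfω)]; ring
    · rw [if_neg heω, if_neg hfω, z11 ω (fun h => heω h.1), z10 ω (fun h => heω h.1), z01 ω (fun h => hfω h.2)]; ring
  have hSDe : ∑ ω, rcWeightW w q ∅ ω * ind (D ∩ Oe) ω = te * tf * m11 + te * (1 - tf) * m10 := by
    simp only [hm10, hm11, Finset.mul_sum, ← Finset.sum_add_distrib]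
    refine Finset.sum_congr rfl fun ω _ => ?_
    by_cases heω : e ∈ ω
    · have hind : ind (D ∩ Oe) ω = ind D ω := by
        by_cases hDω : ω ∈ D
        · rw [ind_of_mem hDω, ind_of_mem (Set.mem_inter hDω heω)]
        · rw [ind_of_not_mem hDω, ind_of_not_mem fun h => hDω h.1]
      rw [hind, hpt ω, if_pos heω]
      by_cases hfω : f ∈ ω
      · rw [if_pos hfω, z10 ω (fun h => h.2 hfω)]; ring
      · rw [if_neg hfω, z11 ω (fun h => hfω h.2)]; ring
    · rw [ind_of_not_mem (fun h : ω ∈ D ∩ Oe => heω h.2), z11 ω (fun h => heω h.1), z10 ω (fun h => heω h.1)]; ring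
  have hSDf : ∑ ω, rcWeightW w q ∅ ω * ind (D ∩ Of) ω = te * tf * m11 + (1 - te) * tf * m01 := by
    simp only [hm01, hm11, Finset.mul_sum, ← Finset.sum_add_distrib]
    refine Finset.sum_congr rfl fun ω _ => ?_
    by_cases hfω : f ∈ ω
    · have hind : ind (D ∩ Of) ω = ind D ω := by
        by_cases hDω : ω ∈ D
        · rw [ind_of_mem hDω, ind_of_mem (Set.mem_inter hDω hfω)]
        · rw [ind_of_not_mem hDω, ind_of_not_mem fun h => hDω h.1]
      rw [hind, hpt ω]
      by_cases heω : e ∈ ω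
      · rw [if_pos heω, if_pos hfω, z01 ω (fun h => h.1 heω)]; ring
      · rw [if_neg heω, if_pos hfω, z11 ω (fun h => heω h.1)]; ring
    · rw [ind_of_not_mem (fun h : ω ∈ D ∩ Of => hfω h.2), z11 ω (fun h => hfω h.2), z01 ω (fun h => hfω h.2)]; ring
  have hSDef : ∑ ω, rcWeightW w q ∅ ω * ind (D ∩ Oe ∩ Of) ω = te * tf * m11 := by
    simp only [hm11, Finset.mul_sum]
    refine Finset.sum_congr rfl fun ω _ => ?_
    by_cases hef' : e ∈ ω ∧ f ∈ ω
    · have hind : ind (D ∩ Oe ∩ Of) ω = ind D ω := by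
        by_cases hDω : ω ∈ D
        · rw [ind_of_mem hDω, ind_of_mem (Set.mem_inter (Set.mem_inter hDω hef'.1) hef'.2)]
        · rw [ind_of_not_mem hDω, ind_of_not_mem fun h => hDω h.1.1]
      rw [hind, hpt ω, if_pos hef'.1, if_pos hef'.2]; ring
    · rw [ind_of_not_mem (fun h : ω ∈ D ∩ Oe ∩ Of => hef' ⟨h.1.2, h.2⟩), z11 ω hef']; ring
  -- the measure-level positive correlation
  have hPC := exitPair_posCorrelation_rc w hq y (S ∪ X) (Set.mem_union_right _ ha) hab
    (Set.mem_union_right _ hc) hcd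
  have hDset : {ω : BondConfig V | ∀ t ∈ S ∪ X, ¬ (openGraph ω).Reachable y t} = D := rfl
  rw [hDset] at hPC
  have hZ := rcPartitionFunctionW_pos w hq0 ∅
  have key : (∑ ω, rcWeightW w q ∅ ω * ind (D ∩ Oe) ω) * (∑ ω, rcWeightW w q ∅ ω * ind (D ∩ Of) ω) ≤
      (∑ ω, rcWeightW w q ∅ ω * ind D ω) * (∑ ω, rcWeightW w q ∅ ω * ind (D ∩ Oe ∩ Of) ω) := by
    rw [← hS D, ← hS (D ∩ Oe), ← hS (D ∩ Of), ← hS (D ∩ Oe ∩ Of)]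
    have := mul_le_mul_of_nonneg_right hPC (mul_nonneg hZ.le hZ.le)
    nlinarith [this]
  rw [hSD, hSDe, hSDf, hSDef] at key
  -- algebra: (c11 m11 + c10 m10)(c11 m11 + c01 m01) ≤ (Σ c m)(c11 m11) ⟺ c10 c01 m10 m01 ≤ c00 c11 m00 m11
  have hte0 : 0 < te := he0
  have hte1 : te < 1 := he1
  have htf0 : 0 < tf := hf0
  have htf1 : tf < 1 := hf1
  have hpos : 0 < te * (1 - tf) * ((1 - te) * tf) := by
    have := sub_pos.2 hte1; have := sub_pos.2 htf1; positivity
  have key2 : te * (1 - tf) * ((1 - te) * tf) * (m01 * m10) ≤ te * (1 - tf) * ((1 - te) * tf) * (m00 * m11) := by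
    nlinarith [key]
  exact le_of_mul_le_mul_left key2 hpos

end ToolsS

end Summit.CriticalPhenomena.PercolationContinuityZ3.Theorems.FK

end
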